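import Summits.Ventures.DiscreteObjects.Hadamard.Order167InvertingIndexFour668

/-!
# H(668): an automorphism of pair order 4 inverting an element of order 167 CYCLES the four row blocks and the four column
# blocks, its square is the Ito involution modulo `⟨σ⟩`, and the centraliser then has index exactly 2 (kernel dictionary)

Framing: lottery ticket; floor = certified bounds/negative ranges.

Cell pub-namedobj (venture DiscreteObjects), target (H), hadamard gen 22 (HANDOFF-H-g21 item 3).  `σ = (π, κ, d, e)` a signed
automorphism of a Hadamard matrix `H` of order `668` with `π^167 = κ^167 = 1`, `(π, κ) ≠ (1,1)` (four row blocks and four column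
blocks = the `σ`-orbits); `ρ = (π', κ', d', e')` a signed automorphism INVERTING `σ` (`π'π = π^μ π'`, `κ'κ = κ^μ κ'`,
`μ ≡ 166 (mod 167)`) of PAIR ORDER 4 (`(π'², κ'²) ≠ (1,1)`; by gen 21 the pair order of a normalising element is `1, 2, 4, 167`
or `334`, and `ρ` is then fixed-point-free).  Kernel consequences of `Order167InvertingIndexFour668`:
* **`inverting_order4_rows`** / **`inverting_order4_cols`**: neither `ρ` nor `ρ²` maps any row (column) into its own
  `σ`-orbit; **`inverting_order4_cycles_blocks`**: for every row `x` the rows `x, ρx, ρ²x, ρ³x` lie in four DISTINCT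
  `σ`-orbits — `ρ` CYCLES the four blocks.
* **`inverting_order4_sq_ito`**: `ρ² σ^{83c}` (for the `c` with `ρ⁴ = σ^c`) is a centralising signed automorphism whose pair is
  a NON-TRIVIAL INVOLUTION — the centraliser of `σ` has index `≥ 2` (the Ito line of gen 21, `Order167IndexTwoIto668`);
* **`inverting_order4_not_index_four`**: and index `4` is impossible (gen 22: with an index-4 centraliser every inverting
  element is a pair-involution) — so **an inverting element of pair order 4 forces `|C(σ) : ±⟨σ⟩| = 2` exactly: the Ito /
  negacyclic `2 × 2` shape, never the Williamson-type shape.**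
DICTIONARY / STRUCTURE of a hypothetical object; no automorphism order and no Hadamard order is excluded; H(668) untouched;
HITS 0/4.  Ours; no `sorry`, no definitions, default heartbeats.
-/

namespace Summit.Ventures.DiscreteObjects.Hadamard

open Finset BigOperators Matrix

open Literature.Combinatorics.Designs.GoethalsSeidel (IsHadamardMatrix)

variable {ι : Type*} [Fintype ι] [DecidableEq ι]

section orderfour
variable {H : Matrix ι ι ℤ} (hH : IsHadamardMatrix H) (hι : Fintype.card ι = 668)
  {π κ π' κ' : Equiv.Perm ι} {d e d' e' : ι → ℤ} (haut : IsSignedAut H π κ d e)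
  (hπ : π ^ 167 = 1) (hκ : κ ^ 167 = 1) (hne : π ≠ 1 ∨ κ ≠ 1)
  (haut' : IsSignedAut H π' κ' d' e') {μ : ℕ} (hnπ : π' * π = π ^ μ * π') (hnκ : κ' * κ = κ ^ μ * κ')
  (hμ : μ % 167 = 166) (hsq : π' ^ 2 ≠ 1 ∨ κ' ^ 2 ≠ 1)
include hH hι haut hπ hκ hne haut' hnπ hnκ hμ hsq

/-- **rows: neither `ρ` nor `ρ²` maps a row into its own `σ`-orbit** -/
theorem inverting_order4_rows : (∀ x, π' x ∉ orbFin π 167 x) ∧ (∀ x, (π' ^ 2) x ∉ orbFin π 167 x) := by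
  refine ⟨fun x hx => ?_, fun x hx => ?_⟩
  · obtain ⟨h1, h2⟩ := inverting_sq_eq_one_of_mem_orbFin hH hι haut hπ hκ hne haut' hnπ hnκ hμ hx
    rcases hsq with h | h
    · exact h h1
    · exact h h2
  · obtain ⟨h1, h2⟩ := inverting_sq_eq_one_of_sq_mem_orbFin hH hι haut hπ hκ hne haut' hnπ hnκ hμ hx
    rcases hsq with h | h
    · exact h h1
    · exact h h2

/-- **columns: neither `ρ` nor `ρ²` maps a column into its own `σ`-orbit** (the row statement for `Hᵀ`) -/
theorem inverting_order4_cols : (∀ y, κ' y ∉ orbFin κ 167 y) ∧ (∀ y, (κ' ^ 2) y ∉ orbFin κ 167 y) := by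
  have hcard : (Fintype.card ι : ℤ) ≠ 0 := by rw [hι]; norm_num
  exact inverting_order4_rows (isHadamard_transpose hH hcard) hι (isSignedAut_transpose haut) hκ hπ hne.symm
    (isSignedAut_transpose haut') hnκ hnπ hμ hsq.symm

/-- **`ρ` cycles the four row blocks**: for every row `x` the `σ`-orbits of `x, ρ x, ρ² x, ρ³ x` are pairwise distinct (hence
are all four blocks). -/
theorem inverting_order4_cycles_blocks (x : ι) :
    orbFin π 167 (π' x) ≠ orbFin π 167 x ∧ orbFin π 167 ((π' ^ 2) x) ≠ orbFin π 167 x ∧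
      orbFin π 167 ((π' ^ 3) x) ≠ orbFin π 167 x ∧ orbFin π 167 ((π' ^ 2) x) ≠ orbFin π 167 (π' x) ∧
      orbFin π 167 ((π' ^ 3) x) ≠ orbFin π 167 (π' x) ∧ orbFin π 167 ((π' ^ 3) x) ≠ orbFin π 167 ((π' ^ 2) x) := by
  obtain ⟨h1, h2⟩ := inverting_order4_rows hH hι haut hπ hκ hne haut' hnπ hnκ hμ hsq
  have p0 : (0 : ℕ) < 167 := by norm_num
  have k1 : ∀ z, orbFin π 167 (π' z) ≠ orbFin π 167 z := fun z h => h1 z (by rw [← h]; exact mem_orbFin_self π p0 _)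
  have k2 : ∀ z, orbFin π 167 ((π' ^ 2) z) ≠ orbFin π 167 z := fun z h => h2 z (by rw [← h]; exact mem_orbFin_self π p0 _)
  -- ρ⁴ ∈ ⟨σ⟩, so orb(ρ³ x) = orb(x) would put ρ(ρ³ x) = ρ⁴ x ∈ orb(x) = orb(ρ³ x)
  obtain ⟨c, hc4, -⟩ := hadamard668_order167_normalizer_pow4_mem hH hι haut hπ hκ hne haut' hnπ hnκ
  have k3 : orbFin π 167 ((π' ^ 3) x) ≠ orbFin π 167 x := by
    intro h
    apply h1 ((π' ^ 3) x)
    rw [h, ← Equiv.Perm.mul_apply, ← pow_succ', hc4]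
    exact pow_apply_mem_orbFin π p0 hπ x c
  refine ⟨k1 x, k2 x, k3, ?_, ?_, ?_⟩
  · intro h; apply k1 (π' x); rw [← h, ← Equiv.Perm.mul_apply, ← pow_two]
  · intro h; apply k2 (π' x); rw [← h, ← Equiv.Perm.mul_apply, ← pow_succ]
  · intro h; apply k1 ((π' ^ 2) x); rw [← h, ← Equiv.Perm.mul_apply, ← pow_succ']

/-- **`ρ²` is the Ito involution modulo `⟨σ⟩`**: with `ρ⁴ = σ^c` (gen 21), `ρ² σ^{83c}` is a CENTRALISING signed automorphism
whose pair is a NON-TRIVIAL INVOLUTION — the centraliser of `σ` has index at least `2` over `±⟨σ⟩`. -/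
theorem inverting_order4_sq_ito : ∃ c : ℕ, ∃ D E : ι → ℤ,
    IsSignedAut H (π' ^ 2 * π ^ (83 * c)) (κ' ^ 2 * κ ^ (83 * c)) D E ∧
    Commute (π' ^ 2 * π ^ (83 * c)) π ∧ Commute (κ' ^ 2 * κ ^ (83 * c)) κ ∧
    (π' ^ 2 * π ^ (83 * c)) ^ 2 = 1 ∧ (κ' ^ 2 * κ ^ (83 * c)) ^ 2 = 1 ∧ π' ^ 2 * π ^ (83 * c) ≠ 1 := by
  obtain ⟨hc2, hc2'⟩ := hadamard668_order167_normalizer_sq_centralizes hH hι haut hπ hκ hne haut' hnπ hnκ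
  obtain ⟨c, hc4, hc4'⟩ := hadamard668_order167_normalizer_pow4_mem hH hι haut hπ hκ hne haut' hnπ hnκ
  refine ⟨c, _, _, isSignedAut_mul (isSignedAut_pow haut' 2) (isSignedAut_pow haut (83 * c)),
    hc2.mul_left (Commute.pow_left (Commute.refl π) _), hc2'.mul_left (Commute.pow_left (Commute.refl κ) _), ?_, ?_, ?_⟩
  · rw [(hc2.pow_right (83 * c)).mul_pow, ← pow_mul, show 2 * 2 = 4 by norm_num, hc4, ← pow_mul, ← pow_add,
      show c + 83 * c * 2 = 167 * c by ring, pow_mul, hπ, one_pow]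
  · rw [(hc2'.pow_right (83 * c)).mul_pow, ← pow_mul, show 2 * 2 = 4 by norm_num, hc4', ← pow_mul, ← pow_add,
      show c + 83 * c * 2 = 167 * c by ring, pow_mul, hκ, one_pow]
  · -- ρ² is not a power of σ: it maps no row into its own orbit
    intro h
    obtain ⟨x⟩ : Nonempty ι := Fintype.card_pos_iff.mp (by rw [hι]; norm_num)
    obtain ⟨-, h2⟩ := inverting_order4_rows hH hι haut hπ hκ hne haut' hnπ hnκ hμ hsq
    apply h2 x
    have e : π' ^ 2 = π ^ (84 * c) := by
      have h84 : π ^ (83 * c) * π ^ (84 * c) = 1 := by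
        rw [← pow_add, show 83 * c + 84 * c = 167 * c by ring, pow_mul, hπ, one_pow]
      calc π' ^ 2 = π' ^ 2 * (π ^ (83 * c) * π ^ (84 * c)) := by rw [h84, mul_one]
        _ = (π' ^ 2 * π ^ (83 * c)) * π ^ (84 * c) := by rw [mul_assoc]
        _ = π ^ (84 * c) := by rw [h, one_mul]
    rw [e]
    exact pow_apply_mem_orbFin π (by norm_num) hπ x _

/-- **an inverting element of pair order 4 is incompatible with an index-4 centraliser**: there are no two signed
automorphisms commuting with `σ` whose pairs are distinct non-trivial involutions (gen 22: these would make every inverting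
element a pair-involution).  With the previous theorem: `|C(σ) : ±⟨σ⟩| = 2` exactly — the Ito shape. -/
theorem inverting_order4_not_index_four {π₁ κ₁ π₂ κ₂ : Equiv.Perm ι} {d₁ e₁ d₂ e₂ : ι → ℤ}
    (h₁ : IsSignedAut H π₁ κ₁ d₁ e₁) (h₂ : IsSignedAut H π₂ κ₂ d₂ e₂) (hc₁ : Commute π₁ π) (hc₁' : Commute κ₁ κ)
    (hc₂ : Commute π₂ π) (hc₂' : Commute κ₂ κ) (hi₁ : π₁ ^ 2 = 1) (hi₁' : κ₁ ^ 2 = 1) (hi₂ : π₂ ^ 2 = 1)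
    (hi₂' : κ₂ ^ 2 = 1) (hne₁ : π₁ ≠ 1 ∨ κ₁ ≠ 1) (hne₂ : π₂ ≠ 1 ∨ κ₂ ≠ 1) : ¬ (π₁ ≠ π₂ ∨ κ₁ ≠ κ₂) := by
  intro hne₁₂
  obtain ⟨h1, h2⟩ := hadamard668_index_four_inverting_sq_eq_one hH hι haut hπ hκ hne h₁ h₂ hc₁ hc₁' hc₂ hc₂' hi₁ hi₁' hi₂
    hi₂' hne₁ hne₂ hne₁₂ haut' hnπ hnκ hμ
  rcases hsq with h | h
  · exact h h1
  · exact h h2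

end orderfour

end Summit.Ventures.DiscreteObjects.Hadamard
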